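import Literature.NumberTheory.EllipticCurves.ZpExtensionRestrict
import HarnessLib

set_option autoImplicit false

/-!
# `ZpExtension.restrict` — topological generators along the restriction (proof companion of
# `ZpExtensionRestrict.lean`)

For the restricted `ℤ_p`-extension `L·K_∞/L` (`ZpExtension.restrict`, `restrictOfFinrankEqTwo`): a topological
generator EXISTS (surjectivity), an element `γ_L ∈ Γ_L` is a topological generator iff `κ(res γ_L) = 1 ∈ ℤ_p`,
and then `κ_L(γ_L) = κ(γ)` for every topological generator `γ` of `κ` — so the `Λ = ℤ_p⟦T⟧`-structures defined
through `γ` (downstairs) and `γ_L` (upstairs) use the same `T` (the compatibility the Shapiro comparison V3 of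
`Cruxes/EisensteinHeartFlatCMInertBadKPrime/LAYER2-VOCAB-BRIEF.md` needs). PROVED; no named fact, no `instance`,
no notation. References: [Washington1997] §13.1–13.2. [folklore]
-/

noncomputable section

open scoped Classical

open Field Literature.NumberTheory.GaloisRepresentations

universe u v

namespace Literature.NumberTheory.EllipticCurves.ZpExtension

variable {K : Type u} [Field K] {p : ℕ} [Fact p.Prime]

/-- `γ_L` is a topological generator of the restricted extension iff `κ(res γ_L) = 1 ∈ ℤ_p`.
[cite: Washington1997, §13.2] -/
theorem isTopGenerator_restrict_iff (κ : ZpExtension K p) (L : Type v) [Field L] [NumberField L]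
    [Algebra K L] (h : Function.Surjective (κ.toContinuousMonoidHom.comp (absGaloisRestrict K L)))
    (γL : absoluteGaloisGroup L) :
    (κ.restrict L h).IsTopGenerator γL ↔ κ (absGaloisRestrict K L γL) = Multiplicative.ofAdd 1 :=
  Iff.rfl

/-- **A topological generator of `L·K_∞/L` exists** (the restriction is surjective).
[cite: Washington1997, §13.2] -/
theorem exists_isTopGenerator_restrict (κ : ZpExtension K p) (L : Type v) [Field L] [NumberField L]
    [Algebra K L] (h : Function.Surjective (κ.toContinuousMonoidHom.comp (absGaloisRestrict K L))) :
    ∃ γL : absoluteGaloisGroup L, (κ.restrict L h).IsTopGenerator γL := by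
  obtain ⟨γL, hγL⟩ := h (Multiplicative.ofAdd 1)
  exact ⟨γL, hγL⟩

/-- **Compatibility of generators**: for topological generators `γ` of `κ` and `γ_L` of the restriction,
`κ_L(γ_L) = κ(γ)` (both are `1 ∈ ℤ_p`); so `res γ_L` and `γ` differ by an element of `Gal(K̄/K_∞)`.
[cite: Washington1997, §13.2] -/
theorem restrict_apply_eq_of_isTopGenerator (κ : ZpExtension K p) (L : Type v) [Field L] [NumberField L]
    [Algebra K L] (h : Function.Surjective (κ.toContinuousMonoidHom.comp (absGaloisRestrict K L)))
    {γ : absoluteGaloisGroup K} {γL : absoluteGaloisGroup L} (hγ : κ.IsTopGenerator γ)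
    (hγL : (κ.restrict L h).IsTopGenerator γL) : κ.restrict L h γL = κ γ := by
  rw [hγL, hγ]

/-- Same, read downstairs: `κ(res γ_L) = κ(γ)`, i.e. `(res γ_L)·γ⁻¹ ∈ Gal(K̄/K_∞)` (`kerSubgroup`).
[cite: Washington1997, §13.2] -/
theorem absGaloisRestrict_mul_inv_mem_kerSubgroup (κ : ZpExtension K p) (L : Type v) [Field L]
    [NumberField L] [Algebra K L]
    (h : Function.Surjective (κ.toContinuousMonoidHom.comp (absGaloisRestrict K L)))
    {γ : absoluteGaloisGroup K} {γL : absoluteGaloisGroup L} (hγ : κ.IsTopGenerator γ)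
    (hγL : (κ.restrict L h).IsTopGenerator γL) :
    absGaloisRestrict K L γL * γ⁻¹ ∈ κ.kerSubgroup := by
  have h1 : κ (absGaloisRestrict K L γL) = κ γ := restrict_apply_eq_of_isTopGenerator κ L h hγ hγL
  rw [mem_kerSubgroup, map_mul, map_inv, h1, mul_inv_cancel]

variable [NumberField K]

/-- **A topological generator of `L·K_∞/L` for `[L : K] = 2`, `p ≠ 2`** exists
(`restrictOfFinrankEqTwo`). [cite: Washington1997, §13.2] -/
theorem exists_isTopGenerator_restrictOfFinrankEqTwo (hp : p ≠ 2) (κ : ZpExtension K p) (L : Type v)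
    [Field L] [NumberField L] [Algebra K L] (hL : Module.finrank K L = 2) :
    ∃ γL : absoluteGaloisGroup L, (κ.restrictOfFinrankEqTwo hp L hL).IsTopGenerator γL :=
  exists_isTopGenerator_restrict κ L _

/-- For `[L : K] = 2`, `p ≠ 2`: generators are compatible, `κ_L(γ_L) = κ(γ)`. [cite: Washington1997, §13.2] -/
theorem restrictOfFinrankEqTwo_apply_eq_of_isTopGenerator (hp : p ≠ 2) (κ : ZpExtension K p)
    (L : Type v) [Field L] [NumberField L] [Algebra K L] (hL : Module.finrank K L = 2)
    {γ : absoluteGaloisGroup K} {γL : absoluteGaloisGroup L} (hγ : κ.IsTopGenerator γ)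
    (hγL : (κ.restrictOfFinrankEqTwo hp L hL).IsTopGenerator γL) :
    κ.restrictOfFinrankEqTwo hp L hL γL = κ γ :=
  restrict_apply_eq_of_isTopGenerator κ L _ hγ hγL

/-! ### Appended: surjectivity for every degree prime to `p` -/

/-- In `ℤ_p`, an integer `m` prime to `p` is a unit. [folklore] -/
private theorem isUnit_natCast_padicInt_of_not_dvd {m : ℕ} (hm : ¬ p ∣ m) : IsUnit ((m : ℕ) : ℤ_[p]) := by
  rw [PadicInt.isUnit_iff]
  have hle : ‖((m : ℕ) : ℤ_[p])‖ ≤ 1 := PadicInt.norm_le_one _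
  have hlt : ¬ ‖((m : ℕ) : ℤ_[p])‖ < 1 := by
    intro h
    have h' : ‖((m : ℤ) : ℤ_[p])‖ < 1 := by exact_mod_cast h
    rw [PadicInt.norm_int_lt_one_iff_dvd] at h'
    exact hm (by exact_mod_cast h')
  exact le_antisymm hle (not_lt.mp hlt)

/-- A subgroup of `ℤ_p` (written multiplicatively) whose index is finite and prime to `p` is everything:
`g^{[ℤ_p : M]} ∈ M` and `[ℤ_p : M]` is invertible in `ℤ_p` (index `0` is excluded by `p ∤ 0` being false). [folklore] -/
private theorem eq_top_of_not_dvd_index (M : Subgroup (Multiplicative ℤ_[p]))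
    (hM : ¬ p ∣ M.index) : M = ⊤ := by
  rw [eq_top_iff]
  intro y _
  obtain ⟨u, hu⟩ := isUnit_natCast_padicInt_of_not_dvd (p := p) hM
  set b : ℤ_[p] := (↑u⁻¹ : ℤ_[p]) * Multiplicative.toAdd y with hb
  have hy : y = (Multiplicative.ofAdd b) ^ M.index := by
    rw [← ofAdd_nsmul, hb, nsmul_eq_mul, ← mul_assoc, ← hu, Units.mul_inv, one_mul, ofAdd_toAdd]
  rw [hy]
  exact Subgroup.pow_index_mem M _

/-- **`κ ∘ res : Γ_L → ℤ_p` is surjective whenever `[L : K]` is prime to `p`** (`L ∩ K_∞ = K`: the index of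
`res(Γ_L)` in `Γ_K` is `[L : K]`, so the image of `κ ∘ res` has index dividing `[L : K]`, prime to `p`, in the
pro-`p` group `ℤ_p`). Generalises `surjective_comp_absGaloisRestrict_of_finrank_eq_two`; use with
`ZpExtension.restrict`. [cite: Washington1997, §13.1] [cite: NeukirchANT1999, Ch. IV §1] -/
theorem surjective_comp_absGaloisRestrict_of_not_dvd_finrank (κ : ZpExtension K p) (L : Type v) [Field L]
    [NumberField L] [Algebra K L] (hL : ¬ p ∣ Module.finrank K L) :
    Function.Surjective (κ.toContinuousMonoidHom.comp (absGaloisRestrict K L)) := by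
  haveI : FiniteDimensional K L := Module.Finite.of_restrictScalars_finite ℚ K L
  set H : Subgroup (absoluteGaloisGroup K) := (absGaloisRestrict K L).range with hH
  set f : absoluteGaloisGroup K →* Multiplicative ℤ_[p] := κ.toContinuousMonoidHom.toMonoidHom with hf
  have hHidx : H.index = Module.finrank K L := nat_card_quotient_range_absGaloisRestrict K L
  have hfs : Function.Surjective f := κ.surjective
  have hMdvd : (H.map f).index ∣ Module.finrank K L := hHidx ▸ Subgroup.index_map_dvd H hfs
  have hMp : ¬ p ∣ (H.map f).index := fun h ↦ hL (h.trans hMdvd)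
  have hM : H.map f = ⊤ := eq_top_of_not_dvd_index _ hMp
  intro y
  have hy : y ∈ H.map f := hM ▸ Subgroup.mem_top y
  obtain ⟨σ, ⟨τ, rfl⟩, hστ⟩ := Subgroup.mem_map.mp hy
  exact ⟨τ, hστ⟩

/-- A topological generator of `L·K_∞/L` exists whenever `[L : K]` is prime to `p`. [cite: Washington1997, §13.2] -/
theorem exists_isTopGenerator_restrict_of_not_dvd_finrank (κ : ZpExtension K p) (L : Type v) [Field L]
    [NumberField L] [Algebra K L] (hL : ¬ p ∣ Module.finrank K L) :
    ∃ γL : absoluteGaloisGroup L,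
      (κ.restrict L (surjective_comp_absGaloisRestrict_of_not_dvd_finrank κ L hL)).IsTopGenerator γL :=
  exists_isTopGenerator_restrict κ L _

end Literature.NumberTheory.EllipticCurves.ZpExtension

end
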